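import Literature.AlgebraicGeometry.Resolution.MacaulayficationColonModules
import Literature.AlgebraicGeometry.Resolution.MacaulayficationSecantCalculus
import HarnessLib

/-!
# `p`-standard systems of parameters, abstractly (Kawasaki 2000, Def. 2.6 with Lemma 2.5 built in)

Topic: `Literature/AlgebraicGeometry/Resolution`. Brick of the proof of the named facts
`KawasakiMacaulayfication` / `CesnaviciusMacaulayfication`. Kawasaki's Cohen–Macaulay blowing
ups (Kawasaki 2000, Thm. 4.1; Česnavičius 2021, Thm. 3.13) are blowing ups of product ideals
built from a **`p`-standard system of parameters** `x₁,…,x_d` of a finite module `M` over a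
Noetherian local ring (Kawasaki 2000, Def. 2.6, after N. T. Cuong; = the reversal of a CM-secant
system of parameters, Česnavičius 2021, Def. 3.1 (ii), Rem. 3.4). The definition in print is

  *`x_d ∈ 𝔞(M)` and `xᵢ ∈ 𝔞(M/(x_{i+1},…,x_d)M)` for `i < d`* (type `d - 1`), where
  `𝔞(N) = ∏_{i < dim N} Ann H^i_𝔪(N)` (Kawasaki 2000, Def. 2.3, after Schenzel),

and the ONLY property of the ideals `𝔞(N)` used in Kawasaki's §2–§3 (2.8–2.10, 3.1–3.3) is
Schenzel's **Lemma 2.5**: *for every system of parameters `w₁,…,w_e` of `N`,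
`(w₁,…,w_{v-1})N : w_v ⊆ (w₁,…,w_{v-1})N : 𝔞(N)`* (Schenzel 1982, Satz 2.4.2). Local
cohomology is not available in Mathlib at this pin, so this file vendors the notion with
Lemma 2.5 BUILT IN: an element `z` "kills the parameter colons of `N`"
(`KillsParameterColons N z`) if `(W)N : w ⊆ (W)N : z` for every part of a system of parameters
`W, w` of `N` (secant sequence, `MacaulayficationSecantSequences.lean`) — exactly what `z ∈ 𝔞(N)`
gives through Lemma 2.5 — and `IsPStandard M xs` asks this of `xᵢ` on `M/(x_{i+1},…,x_d)M` for
every `i`. Kawasaki's theorems 2.9, 2.10, 3.1–3.3 then hold VERBATIM for `IsPStandard` (sequel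
files), and the local-cohomological content is isolated in the single existence statement
"every `M` over a ring with a dualizing complex has a `p`-standard system of parameters"
(Kawasaki 2000, Thm. 2.7 + Lemmas 2.4, 2.5), to be supplied when local duality is available.

* `KillsParameterColons N z`, `KillsParameterColons.colonBy_le_of_quotient` (the condition for
  `N = M/(B)M` read in `M`: `(B, W)M : w ⊆ (B, W)M : z` whenever `B, W, w` is secant for `M`);
* `IsPStandard M xs` (type `d - 1`; general type `s` is not needed for Macaulayfication,
  Česnavičius 2021, Rem. 3.4 and before Thm. 3.10);
* list lemmas used by the sequel: `exists_eq_append_cons_of_sublist_of_ne` (the last gap of a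
  proper sublist), `ofList_eq_of_perm`, `ofList_mono_of_subset`, `IsSecantSequence.of_subperm`.

Everything is proved; no named fact is introduced.

## References

* [Kawasaki2000] T. Kawasaki, *On Macaulayfication of Noetherian schemes*, Trans. AMS 352 (2000)
  2517–2552, Def. 2.3, Lemma 2.4, Lemma 2.5, Def. 2.6, Thm. 2.7.
* [Cesnavicius2021] K. Česnavičius, Duke Math. J. 170 (2021) = arXiv:1810.04493v2, Def. 3.1 (ii),
  Rem. 3.3 (Schenzel's annihilator lemma), Rem. 3.4.
* P. Schenzel, *Dualisierende Komplexe in der lokalen Algebra und Buchsbaum-Ringe*, LNM 907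
  (1982), Satz 2.4.2.

## What is NOT here

The ideal `𝔞(M)` itself and the existence of `p`-standard systems of parameters (Kawasaki 2000,
Lemma 2.4, Thm. 2.7: needs local cohomology / local duality); Kawasaki 2000, 2.9–2.10 (sequel
`MacaulayficationPStandardDSequence.lean`) and §3.
-/

namespace Literature.AlgebraicGeometry.Resolution

open Ideal Submodule Module IsLocalRing
open scoped Pointwise

universe u v

/-! ## List lemmas -/

section Lists

variable {α : Type*}

/-- **The last gap of a proper sublist**: if `L` is a sublist of `K` and `L ≠ K`, then
`K = A ++ b :: B` and `L = A' ++ B` with `A'` a sublist of `A` — `b` is the last entry of `K`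
omitted by `L`, and everything after it lies in `L` (used for "let `l` be the largest element of
`{i,…,d} ∖ Λ`", Kawasaki 2000, proofs of Thm. 2.9 and Cor. 3.3). [folklore] -/
theorem exists_eq_append_cons_of_sublist_of_ne {L K : List α} (h : L.Sublist K) (hne : L ≠ K) :
    ∃ (A A' : List α) (b : α) (B : List α), K = A ++ b :: B ∧ L = A' ++ B ∧ A'.Sublist A := by
  induction h with
  | slnil => exact absurd rfl hne
  | @cons L K a h ih =>
    by_cases hLK : L = K
    · exact ⟨[], [], a, K, rfl, by rw [hLK, List.nil_append], List.Sublist.slnil⟩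
    · obtain ⟨A, A', b, B, rfl, rfl, hA⟩ := ih hLK
      exact ⟨a :: A, A', b, B, rfl, rfl, hA.cons a⟩
  | @cons_cons L K a h ih =>
    have hLK : L ≠ K := fun e => hne (by rw [e])
    obtain ⟨A, A', b, B, rfl, rfl, hA⟩ := ih hLK
    exact ⟨a :: A, a :: A', b, B, rfl, rfl, hA.cons_cons a⟩

end Lists

section Ring

variable {R : Type u} [CommRing R]

/-- Permuted lists generate the same ideal. [folklore] -/
theorem ofList_eq_of_perm {l l' : List R} (h : l.Perm l') : (ofList l : Ideal R) = ofList l' :=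
  congrArg Ideal.span (Set.ext fun _ => h.mem_iff)

/-- `(l) ⊆ (l')` if every entry of `l` occurs in `l'`. [folklore] -/
theorem ofList_mono_of_subset {l l' : List R} (h : ∀ r ∈ l, r ∈ l') :
    (ofList l : Ideal R) ≤ ofList l' :=
  Ideal.span_mono fun r hr => h r hr

/-- `(W, x, B) = (W, B) + (x)`. [folklore] -/
theorem ofList_append_cons (W : List R) (x : R) (B : List R) :
    (ofList (W ++ x :: B) : Ideal R) = ofList (W ++ B) ⊔ span {x} := by
  rw [ofList_eq_of_perm List.perm_middle, ofList_cons, sup_comm]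

end Ring

section Module

variable {R : Type u} [CommRing R] {M : Type v} [AddCommGroup M] [Module R M]

/-- `(W, x, B)M = (W, B)M + xM`. [folklore] -/
theorem ofList_append_cons_smul_top (W : List R) (x : R) (B : List R) :
    (ofList (W ++ x :: B) • ⊤ : Submodule R M) = ofList (W ++ B) • ⊤ ⊔ x • ⊤ := by
  rw [ofList_append_cons, Submodule.sup_smul, Submodule.ideal_span_singleton_smul]

/-! ## Killing parameter colons (Lemma 2.5 as a definition) -/

variable (M) in
/-- **`z` kills the parameter colon modules of `M`** (Schenzel's Lemma — Kawasaki 2000,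
Lemma 2.5 — turned into a definition): for every sequence `W, w` that is secant for `M` (a part
of a system of parameters, Česnavičius 2021, Def. 3.1 (i)), `(W)M :_M w ⊆ (W)M :_M z`. By
Kawasaki 2000, Lemma 2.5 (= Schenzel 1982, Satz 2.4.2) every `z ∈ 𝔞(M) = ∏_{i<dim M} Ann H^i_𝔪(M)`
has this property when `M` is finite over a Noetherian local ring; it is the only consequence of
`z ∈ 𝔞(M)` used in Kawasaki 2000, §2–§3. [cite: Kawasaki2000, Lemma 2.5] -/
def KillsParameterColons (z : R) : Prop :=
  ∀ (W : List R) (w : R), IsSecantSequence M (W ++ [w]) →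
    colonBy (ofList W • ⊤ : Submodule R M) w ≤ colonBy (ofList W • ⊤) z

namespace KillsParameterColons

/-- Powers of parameters are parameters: if `z` kills the parameter colons of `M` and `W, w` is
secant then `(W)M : wⁿ⁺¹ ⊆ (W)M : z` (finite `M`). [cite: Kawasaki2000, Lemma 2.5] -/
theorem colonBy_pow_le [Module.Finite R M] {z : R} (h : KillsParameterColons M z) {W : List R}
    {w : R} (hs : IsSecantSequence M (W ++ [w])) (n : ℕ) :
    colonBy (ofList W • ⊤ : Submodule R M) (w ^ (n + 1)) ≤ colonBy (ofList W • ⊤) z :=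
  h W (w ^ (n + 1)) (hs.append_pow (Nat.succ_pos n))

/-- **The condition for a quotient `M/(B)M`, read in `M`** (how "apply Lemma 2.5 to
`M/(x_{l+1},…,x_d)M`" is used in Kawasaki 2000, proof of Thm. 2.9): if `z` kills the parameter
colons of `M/(B)M` and `B, W, w` is secant for `M`, then `(B, W)M :_M w ⊆ (B, W)M :_M z`.
[cite: Kawasaki2000, Lemma 2.5] -/
theorem colonBy_le_of_quotient {B : List R} {z : R}
    (h : KillsParameterColons (M ⧸ (ofList B • ⊤ : Submodule R M)) z) {W : List R} {w : R}
    (hs : IsSecantSequence M (B ++ W ++ [w])) :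
    colonBy (ofList (B ++ W) • ⊤ : Submodule R M) w ≤ colonBy (ofList (B ++ W) • ⊤) z := by
  rw [List.append_assoc, isSecantSequence_append_iff] at hs
  have key := h W w hs.2
  intro m hm
  rw [mem_colonBy, ofList_append, Submodule.sup_smul, ← mkQ_mem_smul_top_iff, map_smul] at hm ⊢
  exact key hm

end KillsParameterColons

/-! ## `p`-standard systems of parameters -/

section LocalRing

variable [IsLocalRing R]

variable (M) in
/-- **`p`-standard sequence (type `d - 1`)** for the module `M` (Kawasaki 2000, Def. 2.6 with
`s = d - 1`, after Cuong; equivalently, reversed, a CM-secant sequence, Česnavičius 2021,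
Def. 3.1 (ii), Rem. 3.4), with the memberships `xᵢ ∈ 𝔞(M/(x_{i+1},…,x_d)M)` replaced by their
consequence under Schenzel's Lemma 2.5 (`KillsParameterColons`), which is all that Kawasaki's
§2–§3 use: `xs = [x₁,…,x_d] ⊆ 𝔪` is secant for `M` (a part of a system of parameters) and, for
every split `xs = A ++ x :: B`, `x` kills the parameter colons of `M/(B)M`. (No condition
`d = dim M` is imposed: the results below hold for `p`-standard PARTS of systems of parameters, as
in Česnavičius 2021, Thm. 3.10.) [cite: Kawasaki2000, Def. 2.6] -/
structure IsPStandard (xs : List R) : Prop where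
  /-- the entries lie in the maximal ideal -/
  mem_maximalIdeal : ∀ x ∈ xs, x ∈ maximalIdeal R
  /-- `xs` is a part of a system of parameters of `M` -/
  isSecantSequence : IsSecantSequence M xs
  /-- `xᵢ` kills the parameter colons of `M/(x_{i+1},…,x_d)M` -/
  kills : ∀ (A : List R) (x : R) (B : List R), xs = A ++ x :: B →
    KillsParameterColons (M ⧸ (ofList B • ⊤ : Submodule R M)) x

namespace IsPStandard

variable {xs : List R}

/-- Tails of `p`-standard sequences are `p`-standard for the same module (the conditions on
`x_{n+1},…,x_d` do not mention `x₁,…,x_n`; needs `𝔪`-membership for secant sublists).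
[cite: Kawasaki2000, Def. 2.6] -/
theorem drop [IsNoetherianRing R] [Module.Finite R M] (h : IsPStandard M xs) (n : ℕ) :
    IsPStandard M (xs.drop n) where
  mem_maximalIdeal x hx := h.mem_maximalIdeal x (List.mem_of_mem_drop hx)
  isSecantSequence := h.isSecantSequence.sublist (List.drop_sublist n xs) h.mem_maximalIdeal
  kills A x B hsplit := h.kills (xs.take n ++ A) x B (by
    rw [List.append_assoc, ← hsplit, List.take_append_drop])

end IsPStandard

end LocalRing

/-! ## Secant bookkeeping for the sequel -/

section Noetherian

variable [IsNoetherianRing R] [IsLocalRing R] [Module.Finite R M]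

/-- A sub-permutation of a secant sequence in `𝔪` is secant (sublist, then permutation).
[cite: Cesnavicius2021, §3.2] -/
theorem IsSecantSequence.of_subperm {S T : List R} (h : IsSecantSequence M S) (hT : T.Subperm S)
    (hS : ∀ r ∈ S, r ∈ maximalIdeal R) : IsSecantSequence M T := by
  obtain ⟨l, hl, hsub⟩ := hT
  exact (h.sublist hsub hS).of_perm hl fun r hr => hS r (hsub.subset hr)

/-- **"`y₁,…,y_u, xᵢ,…` is a subsystem of parameters"**, product form: if `S ⊆ 𝔪` is secant
for `M` and both `W, a` and `W, b` are sub-permutations of `S`, then `W, ab` is secant for `M`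
(Kawasaki 2000, proof of Prop. 2.8 / Thm. 2.9: "`…, xᵢ^{nᵢ}xⱼ^{nⱼ}` is a subsystem of
parameters"). [cite: Kawasaki2000, Prop. 2.8] -/
theorem IsSecantSequence.append_mul_of_subperm {S W : List R} {a b : R}
    (h : IsSecantSequence M S) (hS : ∀ r ∈ S, r ∈ maximalIdeal R)
    (ha : (W ++ [a]).Subperm S) (hb : (W ++ [b]).Subperm S) :
    IsSecantSequence M (W ++ [a * b]) :=
  (h.of_subperm ha hS).append_mul (h.of_subperm hb hS)

end Noetherian

end Module

end Literature.AlgebraicGeometry.Resolution
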